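import Summits.QuantumFields.YangMills.Theorems.BalabanUVNodesSpineReadingOfRecord13CoPHKComponentSizeBlocksFreshTowerFaces
import Summits.QuantumFields.YangMills.Theorems.BalabanUVNodesN19MGFRoadLiveSelectorTower
import Literature.MathematicalPhysics.QuantumFieldTheory.Balaban1983to89.Node00.DressedClassTelescopingInt

/-!
# THE N20 TOWER's HYPOTHESIS (T) IS A THEOREM AT THE LIVE-PINNED CoPH RECORD: class-wise telescoping of the dressed (2.18) class weights from the record's own
# rows (`zetaUnity ∕ zetaAbs ∕ zetaMeas`), (H-U) and the sign law of `ζ` — via the identity re-pin; hence the N20 faces with hTA ∕ hTB DISCHARGED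

Cell `pub-ymgap`, YM-PLAN Track A (HUMAN RULING D-0062; width push D-0149); seat `pub-ymgap-dag-n20-d` (R134 (a) N20 NE7b s3 = the U5d ∕ `crOfRecord₁₃` lineage, its declarer)
gen 37.  `--kind proof --supports stmt-QuantumFields-27366 --as helper` (K3⁸); COUNT-NEUTRAL; THEOREMS ONLY (0 `def`).  Imports the sibling `…BlocksFreshTowerFaces` (the faces
★★★ `relWeightBound_card_of_oneStepFreshLetters_id_supNear` with hypotheses hTA ∕ hTB = (T)), the n19 lane's `…N19MGFRoadLiveSelectorTower` (dag-n19-c: ★ THE TOWER IDENTITY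
`classWeightOfDatum₉_ppSelLive_eq_ppSelId`, the dressed∕vacuum domination `dressedSlotsOfDatum₉_sandwich_of_ppSelId`, `measurable_dressedSlotsOfDatum₉ ∕ dressedSlotsOfDatum₉_nonneg`;
its sibling `…LiveSelector.slotsOfRecord_eq_exp_mul_dressedSlotsOfDatum₉_zero`) — CITED BY NAME, not restated — and this lineage's `Node00/DressedClassTelescopingInt` ((T) in the
integrable proviso form; ★★★ `sum_fiber_classWeightOfDatum₉_succ_eq_of_sel_id`).  K0c's `Node00/Record12Measurability` (`slotsOfRecord_measurable_integrable_ppSelId`,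
`integrable_tstepOfRecord`, `measurable_wOfRecord_of_localBg`, `measurable_chiSeqOfRecord_of_localBg`), def-T's `isStepUnity_wOfRecord ∕ abs_wOfRecord_le_one ∕ wOfRecord_nonneg ∕
measurable_tstepOfRecord ∕ tstepOfRecord_nonneg` and def-T's record rows (`Stage13HParams.Provisos₁₃CoPH.zetaUnity ∕ zetaAbs ∕ zetaMeas`, `isPrintedAveraged_datumOfRecord₁₃CoPH`) are
consumed by name.  [III] = [Balaban1988Convergent]; [IV] = [Balaban1989LargeFieldI].

WHAT.  §1 (KEY-BLIND, any Stage-9 tuple `ϑ`): ★★ `integrable_dressedSlotsOfDatum₉_of_ppSelId` — at an IDENTITY-pinned tuple F3's dressed slots are integrable at every level `≤ K`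
WITHOUT (H-h) (K0c's integrability of the undressed tower at the identity selector + n19's `e^{|t|}`-domination and scale identity); ★★★ `sum_fiber_classWeightOfDatum₉_succ_eq_of_ppSelLive`
— at a tuple PINNED AT THE LIVE SELECTOR OF RECORD (`ϑ.ppSel = ppSelLiveOfRecord E (wOfRecord₉ ϑ)`), for any datum with measurable averaging, `g 0 = g₀ p.K`, (H-U) `LocalBgMeasurable`,
the ζ-laws (`IsZetaUnity`, `IsZetaAbsLeOne`, `ZetaMeasurable`, `0 ≤ ζ`): `Σ_{s′.init = π} classWeightOfDatum₉ ϑ D g₀ os p g (m+1) t s′ = classWeightOfDatum₉ … m t π` for every `m < p.K`,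
`t`, `π` (class weights at the live re-pin = at the identity re-pin by n19's tower identity; (T) at the identity re-pin by `…_of_sel_id`: support clause automatic, pin void).
§2 (AT THE CoPH RECORD `(θ : Stage13HParams F N) (hP : θ.Provisos₁₃CoPH F N)`): ★★★ `classWeightOfDatum₉_telescoping_A_of_ppSelLive ∕ _B_`: the faces' hTA ∕ hTB VERBATIM, for every
source `t` (no `|t| ≤ 1` needed), GIVEN the live pin `hsel`, (H-U) and `0 ≤ θ.ζ` — the record's rows `zetaUnity ∕ zetaAbs ∕ zetaMeas` and `isPrintedAveraged_datumOfRecord₁₃CoPH`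
supply the rest.  §3 ★★★★ `relWeightBound_card_of_oneStepFreshLetters_id_supNear_of_ppSelLive`: the sibling's face with hTA ∕ hTB DISCHARGED — N20's size-reading
`RelWeightBound … (W K = η₀·2^{−(K+1)})` at the record's carriers from the numerics, `jcut K ≤ K₀ + K`, the live pin, (H-U), `0 ≤ θ.ζ`, and (O) the ONE-STEP FRESH LETTERS hOA ∕ hOB ALONE.
(v1.1, append-only) ★★★★ `relWeightBound_card_of_ageOneStepFreshLetters_id_supNear_of_ppSelLive`: the same on gen 36's age-geometric schedule (`W K = 2^{−(K+1)}`).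

HONEST FRAMING.  [bookkeeping] composition BY NAME; (O) — [LF-II] (1.89) p. 387's KIND at one step, in ratio form — is a HYPOTHESIS inhabited for no family today and NOT
PRINTED as a statement about the (2.18) class weights; the live pin, (H-U) and the sign law of `ζ` are DISPLAYED hypotheses (as def-T's `Stage13Params.rstep₁₃_of_localBg_liveSel`
displays them), not rows; NO weight is bounded, NO estimate proved; nothing of Bałaban's asserted; NE7 ∕ NE7b ∕ NE7c NOT PRINTED for `d = 4` ∕ NOT proved; no `Provisos₁₃CoPH`
inhabitant claimed (K0⁷ OPEN); K3⁸ v7 untouched; N19 ∕ N20 ∕ N21 ∕ N27 NOT discharged; counts UNMOVED (typed 28∕28 · discharged 8∕27); one finite four-torus programme at fixed `ε`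
— NOT ℝ⁴, NOT OS, NOT a mass gap, NOT the Clay problem.  No `def`, no `instance`, no `notation`, no `sorry`; no decl below carries a cite tag.
-/

noncomputable section

open MeasureTheory
open scoped BigOperators
open Finset

namespace YMDAG.UVSplit

open Literature.MathematicalPhysics.QuantumFieldTheory.Balaban1983to89
open Literature.MathematicalPhysics.QuantumFieldTheory.Balaban1983to89.T4Continuum
open Literature.MathematicalPhysics.QuantumFieldTheory.Balaban1983to89.Node00
open Literature.MathematicalPhysics.QuantumFieldTheory.Balaban1983to89.B14.Eq218Concrete
open Literature.MathematicalPhysics.QuantumFieldTheory.Balaban1983to89.B5Eq118OneStroke (iterBlockOf iterBlock)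
open Literature.MathematicalPhysics.QuantumFieldTheory.Balaban1983to89.T4FiniteEpsInhabited
open Summit.QuantumFields.YangMills.BalabanUVNodes.N19MGFRoadLiveSelector (slotsOfRecord_eq_exp_mul_dressedSlotsOfDatum₉_zero)
open Summit.QuantumFields.YangMills.BalabanUVNodes.N19MGFRoadLiveSelectorTower (classWeightOfDatum₉_ppSelLive_eq_ppSelId
  dressedSlotsOfDatum₉_sandwich_of_ppSelId measurable_dressedSlotsOfDatum₉ dressedSlotsOfDatum₉_nonneg)
open T4WeightBudget (RelWeightBound)

/-! ## §1 Key-blind: F3's dressed slots are integrable at the identity re-pin; (T) at a live-pinned Stage-9 tuple -/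

section KeyBlind

variable {F : T4Family} {N : ℕ} [NeZero N]

/-- ★★ **F3's DRESSED SLOTS ARE INTEGRABLE AT AN IDENTITY-PINNED TUPLE, EVERY LEVEL `≤ K`, WITHOUT (H-h).**  K0c's `slotsOfRecord_measurable_integrable_ppSelId` makes the
undressed tower (any normalisation, here `E = 0`) integrable at the identity selector; n19's `slotsOfRecord_eq_exp_mul_dressedSlotsOfDatum₉_zero` identifies it with F3's vacuum
(`t = 0`) dressed tower, and n19's `dressedSlotsOfDatum₉_sandwich_of_ppSelId` dominates the `t`-dressed slots by `e^{|t|}` times the vacuum ones (`0 ≤ w` jointly measurable,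
`|w| ≤ 1`, measurable `χ`, `D.AvgMeasurable`, `g 0 = g₀ p.K`). [bookkeeping] -/
theorem integrable_dressedSlotsOfDatum₉_of_ppSelId (ϑ : Stage9Params F N) (hid : ϑ.ppSel = ppSelIdOfRecord F ϑ.ν ϑ.τ9.M)
    (D : FiniteEpsData F (SU N)) (hD : D.AvgMeasurable) (g₀ : ℕ → ℝ) (os : List (ULoop F)) (p : B12.RunParams) (g : ℕ → ℝ) (hg : g 0 = g₀ p.K)
    (hw0 : ∀ k s' U V', 0 ≤ wOfRecord₉ F N ϑ p g k s' U V') (hwb : ∀ k s' U V', |wOfRecord₉ F N ϑ p g k s' U V'| ≤ 1)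
    (hwm : ∀ k s', Measurable (fun z : GaugeField (F.P p.K) (k + 1) (SU N) × GaugeField (F.P p.K) k (SU N) => wOfRecord₉ F N ϑ p g k s' z.2 z.1))
    (hχm : ∀ k s, Measurable (chiSeqOfRecord F N ϑ.ν ϑ.τ9.M g p.K k s)) (t : ℝ) (k : ℕ) (hk : k ≤ p.K)
    (s : SeqOfRecord F ϑ.ν ϑ.τ9.M g p.K k) :
    Integrable (dressedSlotsOfDatum₉ F N ϑ D g₀ os t p g k s) (fieldMeasure (F.P p.K) k (SU N)) := by
  have hid' : ∀ k (s : SeqOfRecord F ϑ.ν ϑ.τ9.M g p.K (k + 1)), ϑ.ppSel p g (k + 1) s = s := fun k s => by rw [hid]; rfl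
  obtain ⟨-, hi⟩ := slotsOfRecord_measurable_integrable_ppSelId F N ϑ.ν ϑ.τ9 (fun _ => (0 : ℝ)) (w := wOfRecord₉ F N ϑ) (p := p) (g := g)
    (fun k _ s' => hwm k s') (fun k _ s' U V' => hwb k s' U V') (fun k _ s => hχm k s) k hk
  -- the vacuum dressed slot IS the undressed slot at normalisation `E = 0`
  have hvac : ∀ V, dressedSlotsOfDatum₉ F N ϑ D g₀ os 0 p g k s V =
      slotsOfRecord F N ϑ.ν ϑ.τ9 (fun _ => (0 : ℝ)) (wOfRecord₉ F N ϑ) (ppSelIdOfRecord F ϑ.ν ϑ.τ9.M) p g k s V := fun V => by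
    rw [← hid, slotsOfRecord_eq_exp_mul_dressedSlotsOfDatum₉_zero F N ϑ D g₀ os (fun _ => (0 : ℝ)) p g hg k s V]
    simp only [neg_zero, Real.exp_zero, one_mul]
  refine Integrable.mono' ((hi s).const_mul (Real.exp |t|))
    (measurable_dressedSlotsOfDatum₉ F N ϑ D g₀ os p g hD hwm hχm t k s).aestronglyMeasurable (ae_of_all _ fun V => ?_)
  rw [Real.norm_eq_abs, abs_of_nonneg (dressedSlotsOfDatum₉_nonneg F N ϑ D g₀ os p g hw0 t k s V), ← hvac V]
  exact (dressedSlotsOfDatum₉_sandwich_of_ppSelId F N ϑ D g₀ os p g hid' hD hw0 hwm hχm t k s V).2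

open scoped Classical in
/-- ★★★ **(T) AT A LIVE-PINNED STAGE-9 TUPLE.**  For `ϑ` with `ϑ.ppSel = ppSelLiveOfRecord E (wOfRecord₉ ϑ)`, a datum with measurable averaging, `g 0 = g₀ p.K`, (H-U), and the ζ-laws
(unity, `Σ|ζ| ≤ 1`, joint measurability, `0 ≤ ζ`): for every `m < p.K`, `t`, `π`,
`Σ_{s′.init = π} classWeightOfDatum₉ ϑ D g₀ os p g (m+1) t s′ = classWeightOfDatum₉ ϑ D g₀ os p g m t π`.  The class weights at the live re-pin ARE those at the identity re-pin
`{ϑ with ppSel := ppSelIdOfRecord}` (n19's `classWeightOfDatum₉_ppSelLive_eq_ppSelId`), where (T) is `DressedClassTelescopingInt.sum_fiber_classWeightOfDatum₉_succ_eq_of_sel_id` fed by: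
unity `isStepUnity_wOfRecord`; `|w| ≤ 1`, `0 ≤ w`, measurability of `w`, `χ` (def-T ∕ K0c under (H-U), (H-ζ)); integrability of the dressed pieces
(`integrable_dressedSlotsOfDatum₉_of_ppSelId`, K0c's `integrable_tstepOfRecord`) — no (H-h). [bookkeeping] -/
theorem sum_fiber_classWeightOfDatum₉_succ_eq_of_ppSelLive (ϑ : Stage9Params F N) (E : B12.RunParams → ℝ)
    (hsel : ϑ.ppSel = ppSelLiveOfRecord F N ϑ.ν ϑ.τ9 E (wOfRecord₉ F N ϑ))
    (hU : LocalBgMeasurable F N ϑ.ν) (hζu : IsZetaUnity F N ϑ.ν ϑ.τ9.M ϑ.ζ) (hζa : IsZetaAbsLeOne F N ϑ.ν ϑ.τ9.M ϑ.ζ)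
    (hζm : ZetaMeasurable F N ϑ.ζ) (hζ0 : ∀ p g k s Pl Ql RS U V', 0 ≤ ϑ.ζ p g k s Pl Ql RS U V')
    (D : FiniteEpsData F (SU N)) (hD : D.AvgMeasurable) (g₀ : ℕ → ℝ) (os : List (ULoop F)) (p : B12.RunParams) (g : ℕ → ℝ) (hg : g 0 = g₀ p.K)
    (m : ℕ) (hm : m < p.K) (t : ℝ) (π : SeqOfRecord F ϑ.ν ϑ.τ9.M g p.K m) :
    ∑ s' ∈ univ.filter (fun s' : SeqOfRecord F ϑ.ν ϑ.τ9.M g p.K (m + 1) => s'.init = π), classWeightOfDatum₉ F N ϑ D g₀ os p g (m + 1) t s' =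
      classWeightOfDatum₉ F N ϑ D g₀ os p g m t π := by
  -- record suppliers, all levels
  have hw0 : ∀ k s' U V', 0 ≤ wOfRecord₉ F N ϑ p g k s' U V' := fun k s' U V' =>
    wOfRecord_nonneg F N ϑ.ν ϑ.τ9.M p g k ϑ.A₁ hζ0 s' U V'
  have hwb : ∀ k s' U V', |wOfRecord₉ F N ϑ p g k s' U V'| ≤ 1 := fun k s' U V' =>
    abs_wOfRecord_le_one F N ϑ.ν ϑ.τ9.M ϑ.A₁ hζa p g k s' U V'
  have hwm : ∀ k s', Measurable
      (fun z : GaugeField (F.P p.K) (k + 1) (SU N) × GaugeField (F.P p.K) k (SU N) => wOfRecord₉ F N ϑ p g k s' z.2 z.1) := fun k s' =>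
    measurable_wOfRecord_of_localBg hU ϑ.τ9.M ϑ.A₁ hζm p g k s'
  have hχm : ∀ k s, Measurable (chiSeqOfRecord F N ϑ.ν ϑ.τ9.M g p.K k s) := fun k s =>
    measurable_chiSeqOfRecord_of_localBg hU ϑ.τ9.M g p.K k s
  have hχb : ∀ k (s : SeqOfRecord F ϑ.ν ϑ.τ9.M g p.K k), ∀ᵐ U ∂(fieldMeasure (F.P p.K) k (SU N)),
      ‖chiSeqOfRecord F N ϑ.ν ϑ.τ9.M g p.K k s U‖ ≤ 1 := fun k s =>
    ae_of_all _ fun U => by rw [Real.norm_eq_abs]; exact abs_chiSeqOfRecord_le_one F N ϑ.ν ϑ.τ9.M g p.K k s U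
  -- the identity re-pin: class weights agree (n19's tower identity)
  have hcw := fun k t s => classWeightOfDatum₉_ppSelLive_eq_ppSelId F N ϑ D g₀ os p g E hsel hg hD hw0 hwm hχm k t s
  rw [hcw m t π, Finset.sum_congr rfl fun s' _ => hcw (m + 1) t s']
  -- (T) at the identity re-pin, integrable form: support clause automatic, pin void
  have hTint : ∀ k, k ≤ p.K → ∀ s : SeqOfRecord F ϑ.ν ϑ.τ9.M g p.K k,
      Integrable (fun U => chiSeqOfRecord F N ϑ.ν ϑ.τ9.M g p.K k s U *
        dressedSlotsOfDatum₉ F N { ϑ with ppSel := ppSelIdOfRecord F ϑ.ν ϑ.τ9.M } D g₀ os t p g k s U) (fieldMeasure (F.P p.K) k (SU N)) :=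
    fun k hk s => (integrable_dressedSlotsOfDatum₉_of_ppSelId { ϑ with ppSel := ppSelIdOfRecord F ϑ.ν ϑ.τ9.M } rfl D hD g₀ os p g hg
      hw0 hwb hwm hχm t k hk s).bdd_mul (hχm k s).aestronglyMeasurable (hχb k s)
  have hdm := measurable_dressedSlotsOfDatum₉ F N { ϑ with ppSel := ppSelIdOfRecord F ϑ.ν ϑ.τ9.M } D g₀ os p g hD hwm hχm t m
  have hd0 := dressedSlotsOfDatum₉_nonneg F N { ϑ with ppSel := ppSelIdOfRecord F ϑ.ν ϑ.τ9.M } D g₀ os p g hw0 t m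
  exact sum_fiber_classWeightOfDatum₉_succ_eq_of_sel_id F N { ϑ with ppSel := ppSelIdOfRecord F ϑ.ν ϑ.τ9.M } D g₀ os p g m hm t π
    (fun _ => rfl) (isStepUnity_wOfRecord F N ϑ.ν ϑ.τ9.M ϑ.A₁ hζu p g m) (hTint m hm.le π) (hwm m) (hwb m) (hχm (m + 1))
    (fun s' => (hχm (m + 1) s').mul (measurable_tstepOfRecord F N ϑ.ν ϑ.τ9.M (hwm m) hdm (hχm m) s'))
    (fun s' V => mul_nonneg (chiSeqOfRecord_nonneg F N ϑ.ν ϑ.τ9.M g p.K (m + 1) s' V)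
      (tstepOfRecord_nonneg F N ϑ.ν ϑ.τ9.M (hw0 m) hd0 s' V))
    (fun s' => (integrable_tstepOfRecord F N ϑ.ν ϑ.τ9.M hm (hwm m) (hwb m) (hTint m hm.le) s').bdd_mul
      (hχm (m + 1) s').aestronglyMeasurable (hχb (m + 1) s'))

end KeyBlind

/-! ## §2 At the CoPH record: the faces' telescoping hypotheses hTA ∕ hTB, GIVEN the live pin, (H-U) and `0 ≤ ζ` -/

section Record

variable {F : T4Family} {N : ℕ} [NeZero N]
variable (θ : Stage13HParams F N) (hP : θ.Provisos₁₃CoPH F N) (K₀ : ℕ) (g₀ : ℕ → ℝ) (os : List (ULoop F))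

open scoped Classical in
/-- ★★★ **RUN A's (2.18) CLASS WEIGHTS TELESCOPE CLASS-WISE AT THE LIVE-PINNED CoPH RECORD** — the faces' hypothesis hTA, for every source `t`, GIVEN the live pin
`θ.ppSel = ppSelLiveOfRecord (EOfRecord₁₃ θ) (wOfRecord₉ θ)`, (H-U) `LocalBgMeasurable F N θ.ν` and the sign law `0 ≤ θ.ζ`; the record's rows `zetaUnity ∕ zetaAbs ∕ zetaMeas`
and `isPrintedAveraged_datumOfRecord₁₃CoPH` supply the rest (§1; `g 0 = g₀ p.K` is the lineage's `histA₁₃_zero`). [bookkeeping] -/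
theorem classWeightOfDatum₉_telescoping_A_of_ppSelLive
    (hsel : θ.ppSel = ppSelLiveOfRecord F N θ.ν θ.τ9 (EOfRecord₁₃ F N θ.toStage13Params) (wOfRecord₉ F N θ.toStage9Params))
    (hU : LocalBgMeasurable F N θ.ν) (hζsign : ∀ p g k s Pl Ql RS U V', 0 ≤ θ.ζ p g k s Pl Ql RS U V')
    (K : ℕ) (t : ℝ) (m : ℕ) (hm : m < K₀ + K) (π : SeqOfRecord F θ.ν θ.τ9.M (histA₁₃ θ K₀ g₀ K) (K₀ + K) m) :
    ∑ s' ∈ Finset.univ.filter (fun s' : SeqOfRecord F θ.ν θ.τ9.M (histA₁₃ θ K₀ g₀ K) (K₀ + K) (m + 1) => s'.init = π),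
        classWeightOfDatum₉ F N θ.toStage9Params (datumOfRecord₁₃CoPH F N θ hP) g₀ os (runA₁₃ F K₀ g₀ K) (histA₁₃ θ K₀ g₀ K) (m + 1) t s' =
      classWeightOfDatum₉ F N θ.toStage9Params (datumOfRecord₁₃CoPH F N θ hP) g₀ os (runA₁₃ F K₀ g₀ K) (histA₁₃ θ K₀ g₀ K) m t π :=
  sum_fiber_classWeightOfDatum₉_succ_eq_of_ppSelLive θ.toStage9Params (EOfRecord₁₃ F N θ.toStage13Params) hsel hU hP.zetaUnity hP.zetaAbs hP.zetaMeas
    hζsign (datumOfRecord₁₃CoPH F N θ hP) (isPrintedAveraged_datumOfRecord₁₃CoPH F N θ hP).avgMeasurable g₀ os (runA₁₃ F K₀ g₀ K)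
    (histA₁₃ θ K₀ g₀ K) (histA₁₃_zero θ K₀ g₀ K) m hm t π

open scoped Classical in
/-- ★★★ **RUN B's (2.18) CLASS WEIGHTS TELESCOPE CLASS-WISE AT THE LIVE-PINNED CoPH RECORD** — the faces' hypothesis hTB, same provisos (§1 on run B's index). [bookkeeping] -/
theorem classWeightOfDatum₉_telescoping_B_of_ppSelLive
    (hsel : θ.ppSel = ppSelLiveOfRecord F N θ.ν θ.τ9 (EOfRecord₁₃ F N θ.toStage13Params) (wOfRecord₉ F N θ.toStage9Params))
    (hU : LocalBgMeasurable F N θ.ν) (hζsign : ∀ p g k s Pl Ql RS U V', 0 ≤ θ.ζ p g k s Pl Ql RS U V')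
    (K : ℕ) (t : ℝ) (m : ℕ) (hm : m < K₀ + K + 1) (π : SeqOfRecord F θ.ν θ.τ9.M (histB₁₃ θ K₀ g₀ K) (K₀ + K + 1) m) :
    ∑ s' ∈ Finset.univ.filter (fun s' : SeqOfRecord F θ.ν θ.τ9.M (histB₁₃ θ K₀ g₀ K) (K₀ + K + 1) (m + 1) => s'.init = π),
        classWeightOfDatum₉ F N θ.toStage9Params (datumOfRecord₁₃CoPH F N θ hP) g₀ os (runB₁₃ F K₀ g₀ K) (histB₁₃ θ K₀ g₀ K) (m + 1) t s' =
      classWeightOfDatum₉ F N θ.toStage9Params (datumOfRecord₁₃CoPH F N θ hP) g₀ os (runB₁₃ F K₀ g₀ K) (histB₁₃ θ K₀ g₀ K) m t π :=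
  sum_fiber_classWeightOfDatum₉_succ_eq_of_ppSelLive θ.toStage9Params (EOfRecord₁₃ F N θ.toStage13Params) hsel hU hP.zetaUnity hP.zetaAbs hP.zetaMeas
    hζsign (datumOfRecord₁₃CoPH F N θ hP) (isPrintedAveraged_datumOfRecord₁₃CoPH F N θ hP).avgMeasurable g₀ os (runB₁₃ F K₀ g₀ K)
    (histB₁₃ θ K₀ g₀ K) (histB₁₃_zero θ K₀ g₀ K) m hm t π

end Record

/-! ## §3 The N20 face with its telescoping hypotheses DISCHARGED at the live-pinned record -/

section Faces

variable {F : T4Family} {N : ℕ} [NeZero N]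
variable (θ : Stage13HParams F N) (hP : θ.Provisos₁₃CoPH F N) (K₀ : ℕ) (g₀ : ℕ → ℝ) (os : List (ULoop F)) (jcut : ℕ → ℕ) (ϱ k lv : ℕ → ℕ → ℕ)

open scoped Classical in
/-- ★★★★ **THE N20 FACE AT THE RECORD's CARRIERS FROM ONE-STEP FRESH LETTERS ALONE, AT THE LIVE-PINNED CoPH RECORD** (the sibling's ★★★
`relWeightBound_card_of_oneStepFreshLetters_id_supNear` with (T) = hTA ∕ hTB DISCHARGED by §2): same numerics and `jcut K ≤ K₀ + K`; GIVEN the live pin, (H-U) and `0 ≤ θ.ζ`;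
per run ONE letter family — (O) ONE-STEP FRESH LETTERS hOA ∕ hOB verbatim.  Conclusion: `RelWeightBound` at `crOfRecord₁₃K (keyReadingId₁₃ …) (badKeyReadingOfBigComponent₁₃ …
(bigDialOfCard₁₃ K₀ ((2ϱ+1)^4·k·L^{4lv}))) …`'s carriers with `W K := η₀ · 2^{−(K+1)}`. [bookkeeping] -/
theorem relWeightBound_card_of_oneStepFreshLetters_id_supNear_of_ppSelLive (hM : 0 < θ.τ9.M)
    (hsel : θ.ppSel = ppSelLiveOfRecord F N θ.ν θ.τ9 (EOfRecord₁₃ F N θ.toStage13Params) (wOfRecord₉ F N θ.toStage9Params))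
    (hU : LocalBgMeasurable F N θ.ν) (hζsign : ∀ p g k s Pl Ql RS U V', 0 ≤ θ.ζ p g k s Pl Ql RS U V')
    {η : ℕ → ℕ → ℝ} {η₀ : ℝ} (hη0 : ∀ K j, 0 ≤ η K j) (hη1 : ∀ K j, η K j ≤ η₀) (hη₀ : η₀ ≤ 1)
    (hD : ∀ K j, 2 * ((((2 * ϱ K j + 1) ^ 4 : ℕ) : ℝ) * 3 ^ 4 * ((2 * ϱ K j + 1) ^ 4 : ℕ)) ^ 2 * η K j ≤ 1)
    (hks : ∀ K j, Nat.clog 2 (Fintype.card (Site (F.P (K₀ + K)) (lv K j))) + K + j + 3 ≤ k K j) (hlv : ∀ K j, lv K j ≤ F.m + (K₀ + K))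
    (hlvj : ∀ K, ∀ j ∈ Finset.Icc 1 (jcut K), lv K j ≤ j) (hmono : ∀ K i i', 1 ≤ i → i ≤ i' → i' ≤ jcut K → lv K i ≤ lv K i')
    (hjcut : ∀ K, jcut K ≤ K₀ + K)
    {ζ : ℕ → ℕ → ℕ → ℝ} (hζ0 : ∀ K j i, 0 ≤ ζ K j i)
    (hζη : ∀ K, ∀ j ∈ Finset.Icc 1 (jcut K), ∑ i ∈ Finset.Icc 1 j, ((F.L ^ 4) ^ (lv K j - lv K i) : ℝ) * ζ K j i ≤ η K j)
    (hOA : ∀ (K : ℕ) (t : ℝ), |t| ≤ 1 → ∀ j ∈ Finset.Icc 1 (jcut K),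
      ∀ p ∈ sepAnimalCoverFamily (SiteTouch (P := F.P (K₀ + K)) (j := lv K j)) (SupNear (P := F.P (K₀ + K)) (j := lv K j) (ϱ K j)) (k K j),
      ∀ a ∈ p.2.pi (fun b => (Finset.Icc 1 j).sigma fun i => Finset.univ.filter (fun c : Site (F.P (K₀ + K)) (lv K i) =>
        (↑(iterBlock (lv K i) c) : Set (Site (F.P (K₀ + K)) 0)) ⊆ ↑(iterBlock (lv K j) b))),
      ∀ i ∈ Finset.Icc 1 j,
      ∑ π ∈ Finset.univ.filter (fun π : SeqOfRecord F θ.ν θ.τ9.M (histA₁₃ θ K₀ g₀ K) (K₀ + K) i =>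
          ∀ x ∈ p.2.attach, (a x.1 x.2).1 ≤ i →
            (↑(iterBlock (lv K (a x.1 x.2).1) (a x.1 x.2).2) : Set (Site (F.P (K₀ + K)) 0)) ⊆ (π.Λ (a x.1 x.2).1)ᶜ ∧
            (2 ≤ (a x.1 x.2).1 → (↑(iterBlock (lv K (a x.1 x.2).1) (a x.1 x.2).2) : Set (Site (F.P (K₀ + K)) 0)) ⊆ π.Λ ((a x.1 x.2).1 - 1))),
        classWeightOfDatum₉ F N θ.toStage9Params (datumOfRecord₁₃CoPH F N θ hP) g₀ os (runA₁₃ F K₀ g₀ K) (histA₁₃ θ K₀ g₀ K) i t π ≤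
      (∏ x ∈ p.2.attach.filter (fun x => (a x.1 x.2).1 = i), ζ K j (a x.1 x.2).1) *
        ∑ π ∈ Finset.univ.filter (fun π : SeqOfRecord F θ.ν θ.τ9.M (histA₁₃ θ K₀ g₀ K) (K₀ + K) i =>
            ∀ x ∈ p.2.attach, (a x.1 x.2).1 < i →
              (↑(iterBlock (lv K (a x.1 x.2).1) (a x.1 x.2).2) : Set (Site (F.P (K₀ + K)) 0)) ⊆ (π.Λ (a x.1 x.2).1)ᶜ ∧
              (2 ≤ (a x.1 x.2).1 → (↑(iterBlock (lv K (a x.1 x.2).1) (a x.1 x.2).2) : Set (Site (F.P (K₀ + K)) 0)) ⊆ π.Λ ((a x.1 x.2).1 - 1))),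
          classWeightOfDatum₉ F N θ.toStage9Params (datumOfRecord₁₃CoPH F N θ hP) g₀ os (runA₁₃ F K₀ g₀ K) (histA₁₃ θ K₀ g₀ K) i t π)
    (hOB : ∀ (K : ℕ) (t : ℝ), |t| ≤ 1 → ∀ j ∈ Finset.Icc 1 (jcut K),
      ∀ p ∈ sepAnimalCoverFamily (SiteTouch (P := F.P (K₀ + K)) (j := lv K j)) (SupNear (P := F.P (K₀ + K)) (j := lv K j) (ϱ K j)) (k K j),
      ∀ a ∈ p.2.pi (fun b => (Finset.Icc 1 j).sigma fun i => Finset.univ.filter (fun c : Site (F.P (K₀ + K)) (lv K i) =>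
        (↑(iterBlock (lv K i) c) : Set (Site (F.P (K₀ + K)) 0)) ⊆ ↑(iterBlock (lv K j) b))),
      ∀ i ∈ Finset.Icc 1 j,
      ∑ π ∈ Finset.univ.filter (fun π : SeqOfRecord F θ.ν θ.τ9.M (histB₁₃ θ K₀ g₀ K) (K₀ + K + 1) (i + 1) =>
          ∀ x ∈ p.2.attach, (a x.1 x.2).1 ≤ i →
            (↑(iterBlock (lv K (a x.1 x.2).1) (a x.1 x.2).2) : Set (Site (F.P (K₀ + K)) 0)) ⊆
                ((truncShift F θ.ν hM (histB₁₃ θ K₀ g₀ K) π).Λ (a x.1 x.2).1)ᶜ ∧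
            (2 ≤ (a x.1 x.2).1 → (↑(iterBlock (lv K (a x.1 x.2).1) (a x.1 x.2).2) : Set (Site (F.P (K₀ + K)) 0)) ⊆
                (truncShift F θ.ν hM (histB₁₃ θ K₀ g₀ K) π).Λ ((a x.1 x.2).1 - 1))),
        classWeightOfDatum₉ F N θ.toStage9Params (datumOfRecord₁₃CoPH F N θ hP) g₀ os (runB₁₃ F K₀ g₀ K) (histB₁₃ θ K₀ g₀ K) (i + 1) t π ≤
      (∏ x ∈ p.2.attach.filter (fun x => (a x.1 x.2).1 = i), ζ K j (a x.1 x.2).1) *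
        ∑ π ∈ Finset.univ.filter (fun π : SeqOfRecord F θ.ν θ.τ9.M (histB₁₃ θ K₀ g₀ K) (K₀ + K + 1) (i + 1) =>
            ∀ x ∈ p.2.attach, (a x.1 x.2).1 < i →
              (↑(iterBlock (lv K (a x.1 x.2).1) (a x.1 x.2).2) : Set (Site (F.P (K₀ + K)) 0)) ⊆
                  ((truncShift F θ.ν hM (histB₁₃ θ K₀ g₀ K) π).Λ (a x.1 x.2).1)ᶜ ∧
              (2 ≤ (a x.1 x.2).1 → (↑(iterBlock (lv K (a x.1 x.2).1) (a x.1 x.2).2) : Set (Site (F.P (K₀ + K)) 0)) ⊆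
                  (truncShift F θ.ν hM (histB₁₃ θ K₀ g₀ K) π).Λ ((a x.1 x.2).1 - 1))),
          classWeightOfDatum₉ F N θ.toStage9Params (datumOfRecord₁₃CoPH F N θ hP) g₀ os (runB₁₃ F K₀ g₀ K) (histB₁₃ θ K₀ g₀ K) (i + 1) t π) :
    RelWeightBound 1 (classSetK₁₃ θ K₀ g₀ (keyReadingId₁₃ N K₀ F θ hP g₀ os)) (weightAK₁₃ θ hP K₀ g₀ os (keyReadingId₁₃ N K₀ F θ hP g₀ os))
      (weightBK₁₃ θ hP K₀ g₀ os (keyReadingId₁₃ N K₀ F θ hP g₀ os))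
      (badClassK₁₃ θ K₀ g₀ (keyReadingId₁₃ N K₀ F θ hP g₀ os)
        (badKeyReadingOfBigComponent₁₃ N K₀ jcut (bigDialOfCard₁₃ K₀ (fun K j => (2 * ϱ K j + 1) ^ 4 * k K j * (F.L ^ 4) ^ lv K j)) F θ hP g₀ os))
      (fun K => η₀ * (1 / 2) ^ (K + 1)) :=
  relWeightBound_card_of_oneStepFreshLetters_id_supNear θ hP K₀ g₀ os jcut ϱ k lv hM hη0 hη1 hη₀ hD hks hlv hlvj hmono hjcut hζ0 hζη
    (fun K t _ m hm π => classWeightOfDatum₉_telescoping_A_of_ppSelLive θ hP K₀ g₀ os hsel hU hζsign K t m hm π) hOA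
    (fun K t _ m hm π => classWeightOfDatum₉_telescoping_B_of_ppSelLive θ hP K₀ g₀ os hsel hU hζsign K t m hm π) hOB

open scoped Classical in
/-- ★★★★ **THE SAME ON GEN 36's AGE-GEOMETRIC SCHEDULE, AT THE LIVE-PINNED CoPH RECORD** (the sibling's ★★★ `relWeightBound_card_of_ageOneStepFreshLetters_id_supNear` with hTA ∕ hTB
DISCHARGED by §2): rates `ζ K j i = e^{−q K j}·σ K j^{lv K j − lv K i}·τ K j^{j − i}` (`0 ≤ σ`, `L^4·σ ≤ 1`, `0 ≤ τ ≤ ½`), ONE inequality per `(K, j)`, `jcut K ≤ K₀ + K`; GIVEN the live pin,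
(H-U), `0 ≤ θ.ζ`; per run the ONE-STEP FRESH LETTERS hOA ∕ hOB.  Conclusion `RelWeightBound … (W K = 1 · 2^{−(K+1)})`. (v1.1, append-only.) [bookkeeping] -/
theorem relWeightBound_card_of_ageOneStepFreshLetters_id_supNear_of_ppSelLive (q σ τ : ℕ → ℕ → ℝ) (hM : 0 < θ.τ9.M)
    (hsel : θ.ppSel = ppSelLiveOfRecord F N θ.ν θ.τ9 (EOfRecord₁₃ F N θ.toStage13Params) (wOfRecord₉ F N θ.toStage9Params))
    (hU : LocalBgMeasurable F N θ.ν) (hζsign : ∀ p g k s Pl Ql RS U V', 0 ≤ θ.ζ p g k s Pl Ql RS U V')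
    (hσ0 : ∀ K j, 0 ≤ σ K j) (hσ : ∀ K j, ((F.L : ℝ) ^ 4) * σ K j ≤ 1) (hτ0 : ∀ K j, 0 ≤ τ K j) (hτ : ∀ K j, τ K j ≤ 1 / 2)
    (hq : ∀ K, ∀ j ∈ Finset.Icc 1 (jcut K), 2 * ((((2 * ϱ K j + 1) ^ 4 : ℕ) : ℝ) * 3 ^ 4 * ((2 * ϱ K j + 1) ^ 4 : ℕ)) ^ 2 * (2 * Real.exp (-q K j)) ≤ 1)
    (hks : ∀ K j, Nat.clog 2 (Fintype.card (Site (F.P (K₀ + K)) (lv K j))) + K + j + 3 ≤ k K j) (hlv : ∀ K j, lv K j ≤ F.m + (K₀ + K))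
    (hlvj : ∀ K, ∀ j ∈ Finset.Icc 1 (jcut K), lv K j ≤ j) (hmono : ∀ K i i', 1 ≤ i → i ≤ i' → i' ≤ jcut K → lv K i ≤ lv K i')
    (hjcut : ∀ K, jcut K ≤ K₀ + K)
    (hOA : ∀ (K : ℕ) (t : ℝ), |t| ≤ 1 → ∀ j ∈ Finset.Icc 1 (jcut K),
      ∀ p ∈ sepAnimalCoverFamily (SiteTouch (P := F.P (K₀ + K)) (j := lv K j)) (SupNear (P := F.P (K₀ + K)) (j := lv K j) (ϱ K j)) (k K j),
      ∀ a ∈ p.2.pi (fun b => (Finset.Icc 1 j).sigma fun i => Finset.univ.filter (fun c : Site (F.P (K₀ + K)) (lv K i) =>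
        (↑(iterBlock (lv K i) c) : Set (Site (F.P (K₀ + K)) 0)) ⊆ ↑(iterBlock (lv K j) b))),
      ∀ i ∈ Finset.Icc 1 j,
      ∑ π ∈ Finset.univ.filter (fun π : SeqOfRecord F θ.ν θ.τ9.M (histA₁₃ θ K₀ g₀ K) (K₀ + K) i =>
          ∀ x ∈ p.2.attach, (a x.1 x.2).1 ≤ i →
            (↑(iterBlock (lv K (a x.1 x.2).1) (a x.1 x.2).2) : Set (Site (F.P (K₀ + K)) 0)) ⊆ (π.Λ (a x.1 x.2).1)ᶜ ∧
            (2 ≤ (a x.1 x.2).1 → (↑(iterBlock (lv K (a x.1 x.2).1) (a x.1 x.2).2) : Set (Site (F.P (K₀ + K)) 0)) ⊆ π.Λ ((a x.1 x.2).1 - 1))),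
        classWeightOfDatum₉ F N θ.toStage9Params (datumOfRecord₁₃CoPH F N θ hP) g₀ os (runA₁₃ F K₀ g₀ K) (histA₁₃ θ K₀ g₀ K) i t π ≤
      (∏ x ∈ p.2.attach.filter (fun x => (a x.1 x.2).1 = i),
          (Real.exp (-q K j) * σ K j ^ (lv K j - lv K (a x.1 x.2).1) * τ K j ^ (j - (a x.1 x.2).1))) *
        ∑ π ∈ Finset.univ.filter (fun π : SeqOfRecord F θ.ν θ.τ9.M (histA₁₃ θ K₀ g₀ K) (K₀ + K) i =>
            ∀ x ∈ p.2.attach, (a x.1 x.2).1 < i →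
              (↑(iterBlock (lv K (a x.1 x.2).1) (a x.1 x.2).2) : Set (Site (F.P (K₀ + K)) 0)) ⊆ (π.Λ (a x.1 x.2).1)ᶜ ∧
              (2 ≤ (a x.1 x.2).1 → (↑(iterBlock (lv K (a x.1 x.2).1) (a x.1 x.2).2) : Set (Site (F.P (K₀ + K)) 0)) ⊆ π.Λ ((a x.1 x.2).1 - 1))),
          classWeightOfDatum₉ F N θ.toStage9Params (datumOfRecord₁₃CoPH F N θ hP) g₀ os (runA₁₃ F K₀ g₀ K) (histA₁₃ θ K₀ g₀ K) i t π)
    (hOB : ∀ (K : ℕ) (t : ℝ), |t| ≤ 1 → ∀ j ∈ Finset.Icc 1 (jcut K),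
      ∀ p ∈ sepAnimalCoverFamily (SiteTouch (P := F.P (K₀ + K)) (j := lv K j)) (SupNear (P := F.P (K₀ + K)) (j := lv K j) (ϱ K j)) (k K j),
      ∀ a ∈ p.2.pi (fun b => (Finset.Icc 1 j).sigma fun i => Finset.univ.filter (fun c : Site (F.P (K₀ + K)) (lv K i) =>
        (↑(iterBlock (lv K i) c) : Set (Site (F.P (K₀ + K)) 0)) ⊆ ↑(iterBlock (lv K j) b))),
      ∀ i ∈ Finset.Icc 1 j,
      ∑ π ∈ Finset.univ.filter (fun π : SeqOfRecord F θ.ν θ.τ9.M (histB₁₃ θ K₀ g₀ K) (K₀ + K + 1) (i + 1) =>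
          ∀ x ∈ p.2.attach, (a x.1 x.2).1 ≤ i →
            (↑(iterBlock (lv K (a x.1 x.2).1) (a x.1 x.2).2) : Set (Site (F.P (K₀ + K)) 0)) ⊆
                ((truncShift F θ.ν hM (histB₁₃ θ K₀ g₀ K) π).Λ (a x.1 x.2).1)ᶜ ∧
            (2 ≤ (a x.1 x.2).1 → (↑(iterBlock (lv K (a x.1 x.2).1) (a x.1 x.2).2) : Set (Site (F.P (K₀ + K)) 0)) ⊆
                (truncShift F θ.ν hM (histB₁₃ θ K₀ g₀ K) π).Λ ((a x.1 x.2).1 - 1))),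
        classWeightOfDatum₉ F N θ.toStage9Params (datumOfRecord₁₃CoPH F N θ hP) g₀ os (runB₁₃ F K₀ g₀ K) (histB₁₃ θ K₀ g₀ K) (i + 1) t π ≤
      (∏ x ∈ p.2.attach.filter (fun x => (a x.1 x.2).1 = i),
          (Real.exp (-q K j) * σ K j ^ (lv K j - lv K (a x.1 x.2).1) * τ K j ^ (j - (a x.1 x.2).1))) *
        ∑ π ∈ Finset.univ.filter (fun π : SeqOfRecord F θ.ν θ.τ9.M (histB₁₃ θ K₀ g₀ K) (K₀ + K + 1) (i + 1) =>
            ∀ x ∈ p.2.attach, (a x.1 x.2).1 < i →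
              (↑(iterBlock (lv K (a x.1 x.2).1) (a x.1 x.2).2) : Set (Site (F.P (K₀ + K)) 0)) ⊆
                  ((truncShift F θ.ν hM (histB₁₃ θ K₀ g₀ K) π).Λ (a x.1 x.2).1)ᶜ ∧
              (2 ≤ (a x.1 x.2).1 → (↑(iterBlock (lv K (a x.1 x.2).1) (a x.1 x.2).2) : Set (Site (F.P (K₀ + K)) 0)) ⊆
                  (truncShift F θ.ν hM (histB₁₃ θ K₀ g₀ K) π).Λ ((a x.1 x.2).1 - 1))),
          classWeightOfDatum₉ F N θ.toStage9Params (datumOfRecord₁₃CoPH F N θ hP) g₀ os (runB₁₃ F K₀ g₀ K) (histB₁₃ θ K₀ g₀ K) (i + 1) t π) :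
    RelWeightBound 1 (classSetK₁₃ θ K₀ g₀ (keyReadingId₁₃ N K₀ F θ hP g₀ os)) (weightAK₁₃ θ hP K₀ g₀ os (keyReadingId₁₃ N K₀ F θ hP g₀ os))
      (weightBK₁₃ θ hP K₀ g₀ os (keyReadingId₁₃ N K₀ F θ hP g₀ os))
      (badClassK₁₃ θ K₀ g₀ (keyReadingId₁₃ N K₀ F θ hP g₀ os)
        (badKeyReadingOfBigComponent₁₃ N K₀ jcut (bigDialOfCard₁₃ K₀ (fun K j => (2 * ϱ K j + 1) ^ 4 * k K j * (F.L ^ 4) ^ lv K j)) F θ hP g₀ os))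
      (fun K => (1 : ℝ) * (1 / 2) ^ (K + 1)) :=
  relWeightBound_card_of_ageOneStepFreshLetters_id_supNear θ hP K₀ g₀ os jcut ϱ k lv q σ τ hM hσ0 hσ hτ0 hτ hq hks hlv hlvj hmono hjcut
    (fun K t _ m hm π => classWeightOfDatum₉_telescoping_A_of_ppSelLive θ hP K₀ g₀ os hsel hU hζsign K t m hm π) hOA
    (fun K t _ m hm π => classWeightOfDatum₉_telescoping_B_of_ppSelLive θ hP K₀ g₀ os hsel hU hζsign K t m hm π) hOB

end Faces

end YMDAG.UVSplit

end
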